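import Mathlib
import Literature.AlgebraicGeometry.Resolution.RsopMonomialIdeals

/-!
# TropicalLinks / InductiveStep — the snc base frame at a point and the minimal primes over `(t)`

Route `ResolutionOfSingularities/TropicalLinks`, crux `InductiveStep`
(stmt-ResolutionOfSingularities-17233), line `split`, producer brick BS, in support of the base case
of `stub_mainLemma` (matching the LOCAL snc frame with the GLOBAL list of boundary components).

Setting: `R` a Noetherian domain (a chart ring of the regular projective closure), `t ∈ R` (the
equation of the hyperplane at infinity on the chart), `𝔭` a prime of `R` (a point), and in the local
ring `R_𝔭 = Localization.AtPrime 𝔭` a part `x : Fin r → R_𝔭` of a regular system of parameters with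
`√(t R_𝔭) = (∏ x_l)` (the snc clause: the `x_l` are local equations of the boundary components
through the point).

* `tropicalLinks_mem_minimalPrimes_span_prod_iff` — the minimal primes of `(∏ zᵢ)` for a part `z`
  of a regular system of parameters are exactly the `(zᵢ)` (ring-level, adapted from
  `Literature/AlgebraicGeometry/Resolution/SncStrata.lean`).
* `tropicalLinks_baseFrame_minimalPrimes` — **the pull-backs `𝔮_l := (x_l) ∩ R` are exactly the
  minimal primes over `(t)` contained in `𝔭`, without repetition.**  Proof: minimal primes only
  depend on the radical, so the minimal primes of `t R_𝔭` are the `(x_l)`; primes of `R_𝔭`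
  correspond to primes of `R` inside `𝔭` (`IsLocalization.minimalPrimes_map`,
  `Ideal.under_map_of_isLocalizationAtPrime`), and `(x_l) = (x_{l'})` forces `l = l'` since distinct
  members of a regular system of parameters are not associated.
-/

-- single-problem summit: the doubled namespace component `ResolutionOfSingularities` is forced
set_option linter.dupNamespace false

namespace Summit.ResolutionOfSingularities.ResolutionOfSingularities.Theorems

open IsLocalRing Literature.AlgebraicGeometry.Resolution

/-- **The minimal primes of `(∏ zᵢ)` are exactly the `(zᵢ)`** for a part `z` of a regular system of
parameters of a local ring: the `zᵢ` are pairwise non-associated prime elements, so a prime between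
`(∏ zⱼ)` and `(zᵢ)` contains some `zⱼ ∈ (zᵢ)`, forcing `j = i`. [folklore] -/
theorem tropicalLinks_mem_minimalPrimes_span_prod_iff {S : Type*} [CommRing S] [IsLocalRing S]
    {n : ℕ} {z : Fin n → S} (hz : IsRsopPart z) (P : Ideal S) :
    P ∈ (Ideal.span {∏ i, z i}).minimalPrimes ↔ ∃ i, P = Ideal.span {z i} := by
  -- adapted from Literature/AlgebraicGeometry/Resolution/SncStrata.lean
  -- (`IsRsopPart.mem_minimalPrimes_span_prod_iff`), made scheme-free
  haveI := hz.isRegularLocalRing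
  haveI := isDomain_of_isRegularLocalRing S
  have hpr : ∀ i, (Ideal.span {z i}).IsPrime := fun i =>
    (Ideal.span_singleton_prime (hz.ne_zero i)).mpr (hz.prime i)
  have hle : ∀ i, Ideal.span {∏ j, z j} ≤ Ideal.span {z i} := fun i =>
    Ideal.span_singleton_le_span_singleton.mpr (Finset.dvd_prod_of_mem _ (Finset.mem_univ i))
  -- each `(zᵢ)` is a minimal prime over `(∏ zⱼ)`
  have hmin : ∀ i, Ideal.span {z i} ∈ (Ideal.span {∏ j, z j}).minimalPrimes := by
    intro i
    refine ⟨⟨hpr i, hle i⟩, fun Q ⟨hQ, hQle⟩ hQi => ?_⟩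
    have hmem : ∏ j, z j ∈ Q := hQle (Ideal.mem_span_singleton_self _)
    haveI := hQ
    obtain ⟨j, -, hj⟩ := Ideal.IsPrime.prod_mem_iff.mp hmem
    have hji : j = i := by
      by_contra hji
      exact hz.not_dvd (Ne.symm hji) (Ideal.mem_span_singleton.mp (hQi hj))
    subst hji
    exact (Ideal.span_singleton_le_iff_mem _).mpr hj
  constructor
  · intro hP
    haveI := hP.1.1
    have hmem : ∏ i, z i ∈ P := hP.1.2 (Ideal.mem_span_singleton_self _)
    obtain ⟨i, -, hi⟩ := Ideal.IsPrime.prod_mem_iff.mp hmem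
    refine ⟨i, ?_⟩
    have hle' : Ideal.span {z i} ≤ P := (Ideal.span_singleton_le_iff_mem _).mpr hi
    exact le_antisymm (hP.2 (hmin i).1 hle') hle'
  · rintro ⟨i, rfl⟩
    exact hmin i

/-- **The snc base frame at a point matches the minimal primes over the boundary equation.**  For a
Noetherian domain `R`, `t ∈ R`, a prime `𝔭`, and a part `x : Fin r → R_𝔭` of a regular system of
parameters of `R_𝔭 = Localization.AtPrime 𝔭` with `√(t R_𝔭) = (∏ x_l)`: the primes
`𝔮_l := (x_l) ∩ R` are minimal over `(t)` and contained in `𝔭`, `l ↦ 𝔮_l` is injective, and every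
minimal prime over `(t)` contained in `𝔭` is one of the `𝔮_l`. [folklore] -/
theorem tropicalLinks_baseFrame_minimalPrimes : ∀ (R : Type) [CommRing R] [IsDomain R] [IsNoetherianRing R] (t : R) (𝔭 : Ideal R) [𝔭.IsPrime] (r : ℕ) (x : Fin r → Localization.AtPrime 𝔭), Literature.AlgebraicGeometry.Resolution.IsRsopPart x → (Ideal.span {algebraMap R (Localization.AtPrime 𝔭) t}).radical = Ideal.span {∏ l, x l} → (∀ l : Fin r, (Ideal.span {x l}).comap (algebraMap R (Localization.AtPrime 𝔭)) ∈ (Ideal.span {t}).minimalPrimes ∧ (Ideal.span {x l}).comap (algebraMap R (Localization.AtPrime 𝔭)) ≤ 𝔭) ∧ Function.Injective (fun l : Fin r => (Ideal.span {x l}).comap (algebraMap R (Localization.AtPrime 𝔭))) ∧ (∀ 𝔮 ∈ (Ideal.span {t}).minimalPrimes, 𝔮 ≤ 𝔭 → ∃ l : Fin r, 𝔮 = (Ideal.span {x l}).comap (algebraMap R (Localization.AtPrime 𝔭))) := by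
  intro R _ _ _ t 𝔭 _ r x hx hrad
  haveI := hx.isRegularLocalRing
  -- the extension of `(t)` to `R_𝔭` is `(t)`
  have hmap : (Ideal.span {t}).map (algebraMap R (Localization.AtPrime 𝔭)) =
      Ideal.span {algebraMap R (Localization.AtPrime 𝔭) t} := by
    rw [Ideal.map_span, Set.image_singleton]
  -- minimal primes only depend on the radical: those of `t R_𝔭` are the `(x_l)`
  have hmin : ∀ P : Ideal (Localization.AtPrime 𝔭),
      P ∈ ((Ideal.span {t}).map (algebraMap R (Localization.AtPrime 𝔭))).minimalPrimes ↔
        ∃ l, P = Ideal.span {x l} := by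
    intro P
    rw [hmap, ← Ideal.radical_minimalPrimes, hrad]
    exact tropicalLinks_mem_minimalPrimes_span_prod_iff hx P
  -- minimal primes of the extension are the primes contracting to minimal primes of `(t)`
  have hkey := IsLocalization.minimalPrimes_map 𝔭.primeCompl (Localization.AtPrime 𝔭)
    (Ideal.span {t})
  have hA : ∀ l, (Ideal.span {x l}).comap (algebraMap R (Localization.AtPrime 𝔭)) ∈
      (Ideal.span {t}).minimalPrimes := by
    intro l
    have h : Ideal.span {x l} ∈
        ((Ideal.span {t}).map (algebraMap R (Localization.AtPrime 𝔭))).minimalPrimes :=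
      (hmin _).mpr ⟨l, rfl⟩
    rw [hkey] at h
    exact h
  have hB : ∀ l, (Ideal.span {x l}).comap (algebraMap R (Localization.AtPrime 𝔭)) ≤ 𝔭 := by
    intro l
    have hne : Ideal.span {x l} ≠ ⊤ :=
      ((Ideal.span_singleton_prime (hx.ne_zero l)).mpr (hx.prime l)).ne_top
    calc (Ideal.span {x l}).comap (algebraMap R (Localization.AtPrime 𝔭))
        ≤ (maximalIdeal (Localization.AtPrime 𝔭)).comap
            (algebraMap R (Localization.AtPrime 𝔭)) :=
          Ideal.comap_mono (IsLocalRing.le_maximalIdeal hne)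
      _ = 𝔭 := Localization.AtPrime.under_maximalIdeal
  refine ⟨fun l => ⟨hA l, hB l⟩, ?_, ?_⟩
  · -- injectivity: `(x_l) = 𝔮_l R_𝔭`, and `(x_l) = (x_{l'})` forces `l = l'`
    intro l l' h
    have h' : Ideal.span {x l} = Ideal.span {x l'} := by
      rw [← IsLocalization.map_under 𝔭.primeCompl (Localization.AtPrime 𝔭) (Ideal.span {x l}),
        ← IsLocalization.map_under 𝔭.primeCompl (Localization.AtPrime 𝔭) (Ideal.span {x l'})]
      exact congrArg (Ideal.map (algebraMap R (Localization.AtPrime 𝔭))) h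
    haveI := isDomain_of_isRegularLocalRing (Localization.AtPrime 𝔭)
    rw [Ideal.span_singleton_eq_span_singleton] at h'
    by_contra hll'
    exact hx.not_associated hll' h'
  · -- a minimal prime `𝔮 ⊆ 𝔭` over `(t)` extends to a minimal prime of `t R_𝔭`, i.e. some `(x_l)`
    intro 𝔮 h𝔮 h𝔮𝔭
    haveI := h𝔮.1.1
    have hcm : (𝔮.map (algebraMap R (Localization.AtPrime 𝔭))).under R = 𝔮 :=
      Ideal.under_map_of_isLocalizationAtPrime 𝔭 h𝔮𝔭
    have hmem : 𝔮.map (algebraMap R (Localization.AtPrime 𝔭)) ∈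
        ((Ideal.span {t}).map (algebraMap R (Localization.AtPrime 𝔭))).minimalPrimes := by
      rw [hkey, Set.mem_preimage, hcm]
      exact h𝔮
    obtain ⟨l, hl⟩ := (hmin _).mp hmem
    exact ⟨l, by rw [← hl, ← Ideal.under_def, hcm]⟩

end Summit.ResolutionOfSingularities.ResolutionOfSingularities.Theorems
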